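import Literature.AlgebraicGeometry.Motives.HodgeStructureDivisorClassesKunneth
import Mathlib.LinearAlgebra.ExteriorAlgebra.Basis
import Mathlib.RingTheory.Flat.Basic
import HarnessLib

/-!
# Milne 1999, Prop. 4.1, the isomorphism counted: `x ⊗ y ↦ p^*x · q^*y` is injective on `Dᵃ(H₁) ⊗ Dᵇ(H₂)` with independent images,
# `Σ_{a+b=p} dim Dᵃ(H₁) · dim Dᵇ(H₂) ≤ dim Dᵖ(H₁ ⊕ H₂)` always, with equality iff the products span — in particular under `DC = 0`

[topic AlgebraicGeometry/Motives]

Layer `Literature/AlgebraicGeometry/Motives`, lane `lit-hodgefound` (Track 2 foundations library; prover seat `lit-hodgefound-p34`,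
generation 27, row g27-#4). THEOREMS ONLY (no `def`, no named fact, no instance, no notation; net debt `0`). Sequel of the seat's g27-#2
`Motives/HodgeStructureDivisorClassesKunneth` (Milne's Prop. 4.1 as an identity of sub-modules of the exterior algebra `⋀(V ⊕ W)`:
`Dᵖ(H₁ ⊕ H₂) = Σ_{a+b=p} J₁(Dᵃ(H₁)) · J₂(Dᵇ(H₂))` under `DC = 0`, the summands being independent and always inside `Dᵖ(H₁ ⊕ H₂)`), which
left the INJECTIVITY of `x ⊗ y ↦ p^*x · q^*y` on each `Dᵃ(H₁) ⊗ Dᵇ(H₂)` and the resulting DIMENSION COUNT implicit. Here both, on the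
abstract carrier (pure `ℚ`-Hodge structures `H₁`, `H₂` of the same weight on `V`, `W`; `Dᵖ(H) ⊆ ⋀^{2p}`; `J₁ = ⋀(in₁)`, `J₂ = ⋀(in₂)`).

## The source, verbatim

J. S. Milne, *Lefschetz classes on abelian varieties*, Duke Math. J. 96 (1999) [Milne1999LefschetzClasses] (held text
`paper:doi-10-1215-s0012-7094-99-09620-5` p0020 = p. 658), §4: "**Proposition 4.1.** Let `X` and `Y` be smooth complete varieties over `Ω`.
If the `ℚ`-space `DC(X, Y)` of divisorial correspondences between `X` and `Y` is zero, then the map `x ⊗ y ↦ p^*x · q^*y :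
D(X)_k ⊗ D(Y)_k → D(X × Y)_k` is an isomorphism. Here `p` and `q` are the projection maps from `X × Y` to `X` and `Y` respectively." and
"**Corollary 4.2.** An isogeny `A → A₁^{r₁} × ⋯ × A_s^{r_s}` with the `Aᵢ` simple and pairwise nonisogenous abelian varieties defines an
isomorphism of `D(A)_k` onto the subring `D(A₁^{r₁})_k ⊗ ⋯ ⊗ D(A_s^{r_s})_k` of `H^*(A) = H^*(A₁^{r₁}) ⊗ ⋯ ⊗ H^*(A_s^{r_s})`. *Proof.* In general,
`DC(X, Y) ≅ Hom(A, B)` […] if `A` and `B` are abelian varieties with `Hom(A, B) = 0`, then `DC(A, B) = 0` and the projection maps define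
an isomorphism `D(A)_k ⊗ D(B)_k → D(A × B)_k`."

## What is PROVED (no polarization, every weight `n`, unless said)

* §1 MODULE LEVEL (commutative ring `K`; `X ⊆ ⋀ᵃM`, `Y ⊆ ⋀ᵇN` sub-modules): in `⋀(M ⊕ N)`, **`J₁(X) · J₂(Y)` is the image of `X ⊗ Y` under
  Bourbaki's Künneth map `x ⊗ y ↦ J₁x ∧ J₂y`** (`map_map_subtype_mul_map_map_subtype_eq_map_map₂`); over a field that map is
  INJECTIVE on `X ⊗ Y` (`lift_exteriorProdWedge_comp_mapIncl_injective`: p02's `lift_exteriorProdWedge_injective` and flatness), so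
  **`dim (J₁(X) · J₂(Y)) = dim X · dim Y`** (`finrank_map₂_exteriorProdWedge`, `finrank_map_map_subtype_mul_map_map_subtype`).
* §2 HODGE LEVEL: **`x ⊗ y ↦ p^*x · q^*y` is injective on `Dᵃ(H₁) ⊗ Dᵇ(H₂)`** with image the `(a, b)` product
  (`lift_exteriorProdWedge_comp_mapIncl_divisorClasses_injective`, `map_subtype_range_lift_exteriorProdWedge_comp_mapIncl_divisorClasses`),
  **`dim (J₁(Dᵃ(H₁)) · J₂(Dᵇ(H₂))) = dim Dᵃ(H₁) · dim Dᵇ(H₂)`** (`finrank_map_divisorClasses_mul_map_divisorClasses`), the products for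
  `a + b = p` are independent (g27-#2) so **`dim Σ_{a+b=p} (products) = Σ_{a+b=p} dim Dᵃ(H₁) · dim Dᵇ(H₂)`**
  (`finrank_sum_map_divisorClasses_mul_map_divisorClasses`); hence, for finite-dimensional `V`, `W`: the UNCONDITIONAL BOUND
  **`Σ_{a+b=p} dim Dᵃ(H₁) · dim Dᵇ(H₂) ≤ dim Dᵖ(H₁ ⊕ H₂)`** (`sum_finrank_divisorClasses_mul_le_finrank_divisorClasses_prod`), the NUMERICAL
  CRITERION **"`x ⊗ y ↦ p^*x · q^*y` maps onto `Dᵖ(H₁ ⊕ H₂)` iff `dim Dᵖ(H₁ ⊕ H₂) = Σ_{a+b=p} dim Dᵃ(H₁) · dim Dᵇ(H₂)`"**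
  (`map_subtype_divisorClasses_prod_eq_sum_iff_finrank_eq`), and MILNE'S PROP. 4.1 COUNTED: **under `DC = 0`,
  `dim Dᵖ(H₁ ⊕ H₂) = Σ_{a+b=p} dim Dᵃ(H₁) · dim Dᵇ(H₂)`** (`finrank_divisorClasses_prod_eq_sum`; hypothesis also as "mixed part of `B¹` is
  `0`", `…_of_mixed_eq_bot`, and — Cor. 4.2's mechanism, `H₁` polarized, g27-#1 — as `Hom_HS(H₁, H₂) = 0`,
  `Polarization.finrank_divisorClasses_prod_eq_sum_of_subsingleton_hom`).

NOT here: more than two factors / powers `A^r` (Cor. 4.2's induction); the ring structure of `D(X) ⊗ D(Y)` as an abstract tensor product of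
algebras (the tree has no graded tensor product of the two exterior algebras; the statements are about the sub-modules of `⋀(V ⊕ W)`).

## References

* [Milne1999LefschetzClasses] J. S. Milne, *Lefschetz classes on abelian varieties*, Duke Math. J. 96 (1999) 639–675, §4 Prop. 4.1, Cor. 4.2
  (p. 658).
* [BourbakiAlgebre1a3] N. Bourbaki, *Algèbre*, Ch. III §7 no. 7 Prop. 10 and Corollary (the Künneth summands `⋀ᵃM ⊗ ⋀ᵇN ↪ ⋀(M ⊕ N)`).
* [HulekLaface2019PicardNumbersAV] K. Hulek, R. Laface, *On the Picard numbers of abelian varieties*, Ann. Sc. Norm. Super. Pisa (2019), §2.1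
  Prop. 2.2, Cor. 2.3 (`p = 1`: additivity of the Picard number when `Hom = 0`).
-/

noncomputable section

open scoped TensorProduct
open Finset.HasAntidiagonal (antidiagonal mem_antidiagonal)

namespace Literature.AlgebraicGeometry.Motives

/-! ## §1 Module level: `J₁(X) · J₂(Y)` is the injective image of `X ⊗ Y` -/

section CommRing

variable {K : Type*} [CommRing K] {M : Type*} [AddCommGroup M] [Module K M] {N : Type*} [AddCommGroup N] [Module K N]

/-- **`J₁(X) · J₂(Y) = (x ⊗ y ↦ J₁x ∧ J₂y)(X ⊗ Y)`** in the exterior algebra `⋀(M ⊕ N)`, for sub-modules `X ⊆ ⋀ᵃM`, `Y ⊆ ⋀ᵇN`: the product of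
the pushed-forward sub-modules is the image of `X ⊗ Y` under Bourbaki's Künneth map `⋀ᵃM ⊗ ⋀ᵇN → ⋀^{a+b}(M ⊕ N)` (p02's `exteriorProdWedge`),
read in `⋀(M ⊕ N)`. [cite: BourbakiAlgebre1a3, Ch. III §7 no. 7 Prop. 10 (the map `x ⊗ y ↦ ⋀(i₁)x ∧ ⋀(i₂)y`)]
[cite: Milne1999LefschetzClasses, §4 Prop. 4.1 (the map `x ⊗ y ↦ p^*x · q^*y`)] -/
theorem map_map_subtype_mul_map_map_subtype_eq_map_map₂ {a b m : ℕ} (h : a + b = m) (X : Submodule K (⋀[K]^a M))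
    (Y : Submodule K (⋀[K]^b N)) :
    (X.map (⋀[K]^a M).subtype).map (ExteriorAlgebra.map (LinearMap.inl K M N)).toLinearMap *
        (Y.map (⋀[K]^b N).subtype).map (ExteriorAlgebra.map (LinearMap.inr K M N)).toLinearMap =
      (Submodule.map₂ (exteriorProdWedge K M N h) X Y).map (⋀[K]^m (M × N)).subtype := by
  refine le_antisymm (Submodule.mul_le.2 ?_) (Submodule.map_le_iff_le_comap.2 (Submodule.map₂_le.2 fun x hx y hy ↦ ?_))
  · rintro _ ⟨_, ⟨x, hx, rfl⟩, rfl⟩ _ ⟨_, ⟨y, hy, rfl⟩, rfl⟩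
    refine ⟨exteriorProdWedge K M N h x y, Submodule.apply_mem_map₂ _ hx hy, ?_⟩
    rw [Submodule.subtype_apply, exteriorProdWedge_apply, coe_wedgeProductDeg, ExteriorLefschetz.coe_exteriorPower_map,
      ExteriorLefschetz.coe_exteriorPower_map]
    rfl
  · rw [Submodule.mem_comap, Submodule.subtype_apply, exteriorProdWedge_apply, coe_wedgeProductDeg,
      ExteriorLefschetz.coe_exteriorPower_map, ExteriorLefschetz.coe_exteriorPower_map]
    exact Submodule.mul_mem_mul ⟨_, ⟨x, hx, rfl⟩, rfl⟩ ⟨_, ⟨y, hy, rfl⟩, rfl⟩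

end CommRing

section Field

variable {K : Type*} [Field K] {M : Type*} [AddCommGroup M] [Module K M] {N : Type*} [AddCommGroup N] [Module K N]

/-- **The Künneth map `x ⊗ y ↦ J₁x ∧ J₂y` is injective on `X ⊗ Y`** for sub-modules `X ⊆ ⋀ᵃM`, `Y ⊆ ⋀ᵇN` over a field (it is injective on
`⋀ᵃM ⊗ ⋀ᵇN` — Bourbaki's Corollary, p02's `lift_exteriorProdWedge_injective` — and `X ⊗ Y → ⋀ᵃM ⊗ ⋀ᵇN` is injective by flatness).
[cite: BourbakiAlgebre1a3, Ch. III §7 no. 7 Corollary] [cite: Milne1999LefschetzClasses, §4 Prop. 4.1] -/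
theorem lift_exteriorProdWedge_comp_mapIncl_injective {a b m : ℕ} (h : a + b = m) (X : Submodule K (⋀[K]^a M))
    (Y : Submodule K (⋀[K]^b N)) :
    Function.Injective (TensorProduct.lift (exteriorProdWedge K M N h) ∘ₗ TensorProduct.mapIncl X Y) := by
  -- instance search does not find `Module.Free K ↥Y` through the nested coercions `Y ⊆ ⋀ᵇN ⊆ ⋀N`; give it by hand
  haveI : Module.Free K ↥Y := Module.Free.of_divisionRing K ↥Y
  exact (lift_exteriorProdWedge_injective h).comp
    (TensorProduct.map_injective_of_flat_flat _ _ X.injective_subtype Y.injective_subtype)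

/-- **`dim (x ⊗ y ↦ J₁x ∧ J₂y)(X ⊗ Y) = dim X · dim Y`** (over a field). [cite: BourbakiAlgebre1a3, Ch. III §7 no. 7 Corollary]
[cite: Milne1999LefschetzClasses, §4 Prop. 4.1] -/
theorem finrank_map₂_exteriorProdWedge {a b m : ℕ} (h : a + b = m) (X : Submodule K (⋀[K]^a M)) (Y : Submodule K (⋀[K]^b N)) :
    Module.finrank K ↥(Submodule.map₂ (exteriorProdWedge K M N h) X Y) = Module.finrank K ↥X * Module.finrank K ↥Y := by
  haveI : Module.Free K ↥X := Module.Free.of_divisionRing K ↥X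
  haveI : Module.Free K ↥Y := Module.Free.of_divisionRing K ↥Y
  rw [TensorProduct.map₂_eq_range_lift_comp_mapIncl, LinearMap.finrank_range_of_inj (lift_exteriorProdWedge_comp_mapIncl_injective h X Y),
    Module.finrank_tensorProduct]

/-- **`dim (J₁(X) · J₂(Y)) = dim X · dim Y`** in `⋀(M ⊕ N)`, for sub-modules `X ⊆ ⋀ᵃM`, `Y ⊆ ⋀ᵇN` over a field.
[cite: BourbakiAlgebre1a3, Ch. III §7 no. 7 Prop. 10 and Corollary] [cite: Milne1999LefschetzClasses, §4 Prop. 4.1] -/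
theorem finrank_map_map_subtype_mul_map_map_subtype {a b : ℕ} (X : Submodule K (⋀[K]^a M)) (Y : Submodule K (⋀[K]^b N)) :
    Module.finrank K ↥((X.map (⋀[K]^a M).subtype).map (ExteriorAlgebra.map (LinearMap.inl K M N)).toLinearMap *
        (Y.map (⋀[K]^b N).subtype).map (ExteriorAlgebra.map (LinearMap.inr K M N)).toLinearMap) =
      Module.finrank K ↥X * Module.finrank K ↥Y := by
  rw [map_map_subtype_mul_map_map_subtype_eq_map_map₂ rfl,
    ← (Submodule.equivMapOfInjective _ ((⋀[K]^(a + b) (M × N)).injective_subtype) _).finrank_eq, finrank_map₂_exteriorProdWedge]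

/-- `dim (Σ_{i ∈ s} f i) = Σ_{i ∈ s} dim (f i)` for a family of sub-modules of a finite-dimensional space that is independent over `s`
(`Σ = ⨆` is the range of the injective `⊕_{i ∈ s} f i → M`). [folklore] -/
private theorem finrank_finsetSum_eq_sum_of_iSupIndep {E : Type*} [AddCommGroup E] [Module K E] [Module.Finite K E] {ι : Type*}
    (s : Finset ι) (f : ι → Submodule K E) (hind : iSupIndep fun i : ↥s ↦ f i) :
    Module.finrank K ↥(∑ i ∈ s, f i) = ∑ i ∈ s, Module.finrank K ↥(f i) := by
  classical
  let q : ↥s → Submodule K E := fun i ↦ f i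
  have hqind : iSupIndep q := hind
  have hsum : ∑ i ∈ s, f i = ⨆ i, q i := by
    refine le_antisymm (Finset.sum_induction f (fun S ↦ S ≤ ⨆ i, q i) (fun S T hS hT ↦ ?_) ?_ fun i hi ↦ le_iSup q ⟨i, hi⟩)
      (iSup_le fun i ↦ Finset.single_le_sum (f := f) (fun _ _ ↦ by rw [Submodule.zero_eq_bot]; exact bot_le) i.2)
    · rw [Submodule.add_eq_sup]; exact sup_le hS hT
    · rw [Submodule.zero_eq_bot]; exact bot_le
  rw [hsum, Submodule.iSup_eq_range_dfinsupp_lsum q, LinearMap.finrank_range_of_inj hqind.dfinsupp_lsum_injective,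
    (DFinsupp.linearEquivFunOnFintype (R := K) (M := fun i : ↥s ↦ ↥(q i))).finrank_eq, Module.finrank_pi_fintype,
    ← Finset.sum_coe_sort s]

end Field

namespace HodgeStructure

universe u v

/-! ## §2 Hodge level: the products `J₁(Dᵃ(H₁)) · J₂(Dᵇ(H₂))` counted -/

section Rank

variable {V : Type u} [AddCommGroup V] [Module ℚ V] {W : Type v} [AddCommGroup W] [Module ℚ W] {n : ℤ}
  (H₁ : HodgeStructure V n) (H₂ : HodgeStructure W n)

/-- **`x ⊗ y ↦ p^*x · q^*y` is INJECTIVE on `Dᵃ(H₁) ⊗ Dᵇ(H₂)`** (as Bourbaki's Künneth map `⋀^{2a}V ⊗ ⋀^{2b}W → ⋀^{2(a+b)}(V ⊕ W)` restricted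
to the divisor classes). No hypothesis. [cite: Milne1999LefschetzClasses, §4 Prop. 4.1 (p. 658)] [cite: BourbakiAlgebre1a3, Ch. III §7 no. 7 Corollary] -/
theorem lift_exteriorProdWedge_comp_mapIncl_divisorClasses_injective (a b : ℕ) :
    Function.Injective (TensorProduct.lift (exteriorProdWedge ℚ V W (mul_add 2 a b).symm) ∘ₗ
      TensorProduct.mapIncl (H₁.divisorClasses a) (H₂.divisorClasses b)) :=
  lift_exteriorProdWedge_comp_mapIncl_injective _ _ _

/-- **Its image is the `(a, b)` product**: read in `⋀(V ⊕ W)`, the range of `x ⊗ y ↦ p^*x · q^*y` on `Dᵃ(H₁) ⊗ Dᵇ(H₂)` is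
`J₁(Dᵃ(H₁)) · J₂(Dᵇ(H₂))`. [cite: Milne1999LefschetzClasses, §4 Prop. 4.1 (p. 658)] [cite: BourbakiAlgebre1a3, Ch. III §7 no. 7 Prop. 10] -/
theorem map_subtype_range_lift_exteriorProdWedge_comp_mapIncl_divisorClasses (a b : ℕ) :
    (LinearMap.range (TensorProduct.lift (exteriorProdWedge ℚ V W (mul_add 2 a b).symm) ∘ₗ
        TensorProduct.mapIncl (H₁.divisorClasses a) (H₂.divisorClasses b))).map (⋀[ℚ]^(2 * (a + b)) (V × W)).subtype =
      ((H₁.divisorClasses a).map (⋀[ℚ]^(2 * a) V).subtype).map (ExteriorAlgebra.map (LinearMap.inl ℚ V W)).toLinearMap *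
        ((H₂.divisorClasses b).map (⋀[ℚ]^(2 * b) W).subtype).map (ExteriorAlgebra.map (LinearMap.inr ℚ V W)).toLinearMap := by
  rw [← TensorProduct.map₂_eq_range_lift_comp_mapIncl, ← map_map_subtype_mul_map_map_subtype_eq_map_map₂]

/-- **`dim (J₁(Dᵃ(H₁)) · J₂(Dᵇ(H₂))) = dim Dᵃ(H₁) · dim Dᵇ(H₂)`** — each product of pulled-back divisor classes has the dimension of
`Dᵃ(H₁) ⊗ Dᵇ(H₂)`. No hypothesis. [cite: Milne1999LefschetzClasses, §4 Prop. 4.1 (p. 658)] [cite: BourbakiAlgebre1a3, Ch. III §7 no. 7 Corollary] -/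
theorem finrank_map_divisorClasses_mul_map_divisorClasses (a b : ℕ) :
    Module.finrank ℚ
        ↥(((H₁.divisorClasses a).map (⋀[ℚ]^(2 * a) V).subtype).map (ExteriorAlgebra.map (LinearMap.inl ℚ V W)).toLinearMap *
          ((H₂.divisorClasses b).map (⋀[ℚ]^(2 * b) W).subtype).map (ExteriorAlgebra.map (LinearMap.inr ℚ V W)).toLinearMap) =
      Module.finrank ℚ ↥(H₁.divisorClasses a) * Module.finrank ℚ ↥(H₂.divisorClasses b) :=
  finrank_map_map_subtype_mul_map_map_subtype _ _

variable [Module.Finite ℚ V] [Module.Finite ℚ W]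

/-- **`dim Σ_{a+b=p} J₁(Dᵃ(H₁)) · J₂(Dᵇ(H₂)) = Σ_{a+b=p} dim Dᵃ(H₁) · dim Dᵇ(H₂)`** — the products are independent (g27-#2's
`iSupIndep_map_divisorClasses_mul_map_divisorClasses`, Bourbaki's Künneth decomposition) and each has dimension `dim Dᵃ · dim Dᵇ`: the
source `⊕_{a+b=p} Dᵃ(H₁) ⊗ Dᵇ(H₂)` of `x ⊗ y ↦ p^*x · q^*y` embeds. No hypothesis (finite-dimensional `V`, `W`).
[cite: Milne1999LefschetzClasses, §4 Prop. 4.1 (p. 658)] [cite: BourbakiAlgebre1a3, Ch. III §7 no. 7 Prop. 10 and Corollary] -/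
theorem finrank_sum_map_divisorClasses_mul_map_divisorClasses (p : ℕ) :
    Module.finrank ℚ ↥(∑ ab ∈ antidiagonal p,
        ((H₁.divisorClasses ab.1).map (⋀[ℚ]^(2 * ab.1) V).subtype).map (ExteriorAlgebra.map (LinearMap.inl ℚ V W)).toLinearMap *
          ((H₂.divisorClasses ab.2).map (⋀[ℚ]^(2 * ab.2) W).subtype).map (ExteriorAlgebra.map (LinearMap.inr ℚ V W)).toLinearMap) =
      ∑ ab ∈ antidiagonal p, Module.finrank ℚ ↥(H₁.divisorClasses ab.1) * Module.finrank ℚ ↥(H₂.divisorClasses ab.2) := by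
  haveI : Module.Finite ℚ (ExteriorAlgebra ℚ (V × W)) := Module.Finite.of_basis (Module.finBasis ℚ (V × W)).ExteriorAlgebra
  refine (finrank_finsetSum_eq_sum_of_iSupIndep _ _ ?_).trans
    (Finset.sum_congr rfl fun ab _ ↦ finrank_map_divisorClasses_mul_map_divisorClasses H₁ H₂ ab.1 ab.2)
  exact iSupIndep_map_divisorClasses_mul_map_divisorClasses H₁ H₂ p

/-- **THE UNCONDITIONAL BOUND `Σ_{a+b=p} dim Dᵃ(H₁) · dim Dᵇ(H₂) ≤ dim Dᵖ(H₁ ⊕ H₂)`**: `x ⊗ y ↦ p^*x · q^*y` embeds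
`⊕_{a+b=p} Dᵃ(H₁) ⊗ Dᵇ(H₂)` into `Dᵖ(H₁ ⊕ H₂)` (injective with independent images inside `Dᵖ`, g27-#2's
`sum_map_divisorClasses_mul_map_divisorClasses_le`), whatever the divisorial correspondences. [cite: Milne1999LefschetzClasses, §4 Prop. 4.1 (p. 658)] -/
theorem sum_finrank_divisorClasses_mul_le_finrank_divisorClasses_prod (p : ℕ) :
    ∑ ab ∈ antidiagonal p, Module.finrank ℚ ↥(H₁.divisorClasses ab.1) * Module.finrank ℚ ↥(H₂.divisorClasses ab.2) ≤
      Module.finrank ℚ ↥((H₁.prod H₂).divisorClasses p) := by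
  haveI : Module.Finite ℚ (ExteriorAlgebra ℚ (V × W)) := Module.Finite.of_basis (Module.finBasis ℚ (V × W)).ExteriorAlgebra
  rw [← finrank_sum_map_divisorClasses_mul_map_divisorClasses H₁ H₂ p,
    (Submodule.equivMapOfInjective _ ((⋀[ℚ]^(2 * p) (V × W)).injective_subtype) ((H₁.prod H₂).divisorClasses p)).finrank_eq]
  exact Submodule.finrank_mono (sum_map_divisorClasses_mul_map_divisorClasses_le H₁ H₂ p)

/-- **NUMERICAL CRITERION: `x ⊗ y ↦ p^*x · q^*y` maps `⊕_{a+b=p} Dᵃ(H₁) ⊗ Dᵇ(H₂)` ONTO `Dᵖ(H₁ ⊕ H₂)` iff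
`dim Dᵖ(H₁ ⊕ H₂) = Σ_{a+b=p} dim Dᵃ(H₁) · dim Dᵇ(H₂)`** (it is always injective with image inside `Dᵖ`).
[cite: Milne1999LefschetzClasses, §4 Prop. 4.1 (p. 658)] [cite: HulekLaface2019PicardNumbersAV, §2.1 Prop. 2.2, Cor. 2.3 (`p = 1`)] -/
theorem map_subtype_divisorClasses_prod_eq_sum_iff_finrank_eq (p : ℕ) :
    ((H₁.prod H₂).divisorClasses p).map (⋀[ℚ]^(2 * p) (V × W)).subtype =
        ∑ ab ∈ antidiagonal p,
          ((H₁.divisorClasses ab.1).map (⋀[ℚ]^(2 * ab.1) V).subtype).map (ExteriorAlgebra.map (LinearMap.inl ℚ V W)).toLinearMap *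
            ((H₂.divisorClasses ab.2).map (⋀[ℚ]^(2 * ab.2) W).subtype).map (ExteriorAlgebra.map (LinearMap.inr ℚ V W)).toLinearMap ↔
      Module.finrank ℚ ↥((H₁.prod H₂).divisorClasses p) =
        ∑ ab ∈ antidiagonal p, Module.finrank ℚ ↥(H₁.divisorClasses ab.1) * Module.finrank ℚ ↥(H₂.divisorClasses ab.2) := by
  haveI : Module.Finite ℚ (ExteriorAlgebra ℚ (V × W)) := Module.Finite.of_basis (Module.finBasis ℚ (V × W)).ExteriorAlgebra
  rw [← finrank_sum_map_divisorClasses_mul_map_divisorClasses H₁ H₂ p,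
    (Submodule.equivMapOfInjective _ ((⋀[ℚ]^(2 * p) (V × W)).injective_subtype) ((H₁.prod H₂).divisorClasses p)).finrank_eq]
  exact ⟨fun h ↦ by rw [h], fun h ↦
    (Submodule.eq_of_le_of_finrank_eq (sum_map_divisorClasses_mul_map_divisorClasses_le H₁ H₂ p) h.symm).symm⟩

/-- **MILNE 1999, PROP. 4.1, COUNTED: under `DC = 0` (Milne's diagram `D¹(H₁ ⊕ H₂) = p^*D¹(H₁) ⊕ q^*D¹(H₂)`, i.e.
`B¹(H₁ ⊕ H₂) = ⋀²in₁ B¹(H₁) ⊔ ⋀²in₂ B¹(H₂)`), `dim Dᵖ(H₁ ⊕ H₂) = Σ_{a+b=p} dim Dᵃ(H₁) · dim Dᵇ(H₂)`** for every `p` — "the map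
`x ⊗ y ↦ p^*x · q^*y : D(X) ⊗ D(Y) → D(X × Y)` is an isomorphism" (g27-#2's `map_subtype_divisorClasses_prod_eq_sum` is its surjectivity;
injectivity above). [cite: Milne1999LefschetzClasses, §4 Prop. 4.1 (p. 658)] -/
theorem finrank_divisorClasses_prod_eq_sum
    (hDC : ((H₁.prod H₂).exteriorPower 2).hodgeClasses n =
      ((H₁.exteriorPower 2).hodgeClasses n).map (_root_.exteriorPower.map 2 (LinearMap.inl ℚ V W)) ⊔
        ((H₂.exteriorPower 2).hodgeClasses n).map (_root_.exteriorPower.map 2 (LinearMap.inr ℚ V W)))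
    (p : ℕ) :
    Module.finrank ℚ ↥((H₁.prod H₂).divisorClasses p) =
      ∑ ab ∈ antidiagonal p, Module.finrank ℚ ↥(H₁.divisorClasses ab.1) * Module.finrank ℚ ↥(H₂.divisorClasses ab.2) :=
  (map_subtype_divisorClasses_prod_eq_sum_iff_finrank_eq H₁ H₂ p).1 (map_subtype_divisorClasses_prod_eq_sum H₁ H₂ hDC p)

/-- Prop. 4.1 counted, hypothesis in the form **"the mixed part of `B¹(H₁ ⊕ H₂)` vanishes"** (`B¹ ⊓ ker ⋀²pr₁ ⊓ ker ⋀²pr₂ = 0`, g26-#7's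
reading of `DC(X, Y) = 0`). [cite: Milne1999LefschetzClasses, §4 Prop. 4.1 (p. 658)] -/
theorem finrank_divisorClasses_prod_eq_sum_of_mixed_eq_bot
    (hDC : ((H₁.prod H₂).exteriorPower 2).hodgeClasses n ⊓ LinearMap.ker (_root_.exteriorPower.map 2 (LinearMap.fst ℚ V W)) ⊓
      LinearMap.ker (_root_.exteriorPower.map 2 (LinearMap.snd ℚ V W)) = ⊥)
    (p : ℕ) :
    Module.finrank ℚ ↥((H₁.prod H₂).divisorClasses p) =
      ∑ ab ∈ antidiagonal p, Module.finrank ℚ ↥(H₁.divisorClasses ab.1) * Module.finrank ℚ ↥(H₂.divisorClasses ab.2) :=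
  finrank_divisorClasses_prod_eq_sum H₁ H₂ ((hodgeClasses_exteriorPower_prod_eq_sup_map_iff H₁ H₂ two_ne_zero n).2 hDC) p

end Rank

/-! ### Corollary 4.2's mechanism: `DC(H₁, H₂) ≅ Hom_HS(H₁, H₂) = 0` (one polarization, every weight — g27-#1) -/

section Hom

variable {V : Type u} [AddCommGroup V] [Module ℚ V] [Module.Finite ℚ V] {W : Type u} [AddCommGroup W] [Module ℚ W]
  [Module.Finite ℚ W] {n : ℤ} [HodgeTensorFacts.{u, u}] {H₁ : HodgeStructure V n} (Q₁ : Polarization H₁) (H₂ : HodgeStructure W n)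

include Q₁ in
/-- **`Hom_HS(H₁, H₂) = 0 ⟹ dim Dᵖ(H₁ ⊕ H₂) = Σ_{a+b=p} dim Dᵃ(H₁) · dim Dᵇ(H₂)`** (`H₁` polarized, every weight): "if `Hom(A, B) = 0`,
then `DC(A, B) = 0` and the projection maps define an isomorphism `D(A) ⊗ D(B) → D(A × B)`" — `DC = B¹_{mixed} ≃ Hom_HS` is g27-#1's
`Polarization.homEquivMixedDivisorClasses`. [cite: Milne1999LefschetzClasses, §4 Prop. 4.1 and Cor. 4.2 (proof) (p. 658)] -/
theorem Polarization.finrank_divisorClasses_prod_eq_sum_of_subsingleton_hom [Subsingleton (Hom H₁ H₂)] (p : ℕ) :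
    Module.finrank ℚ ↥((H₁.prod H₂).divisorClasses p) =
      ∑ ab ∈ antidiagonal p, Module.finrank ℚ ↥(H₁.divisorClasses ab.1) * Module.finrank ℚ ↥(H₂.divisorClasses ab.2) :=
  finrank_divisorClasses_prod_eq_sum H₁ H₂ ((Q₁.hodgeClasses_two_prod_eq_sup_map_iff_subsingleton_hom_left H₂).2 ‹_›) p

end Hom

end HodgeStructure

end Literature.AlgebraicGeometry.Motives

end
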